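import Summits.MatrixMultiplication.OmegaCensus.DominoZpZpCells
import Summits.MatrixMultiplication.OmegaCensus.DominoZ19Z19Cells
import Summits.MatrixMultiplication.OmegaCensus.DominoZ19Z19Cover4A
import Summits.MatrixMultiplication.OmegaCensus.DominoZ19Z19Cover4B
import Summits.MatrixMultiplication.OmegaCensus.DominoZ19Z19Cover4S
import HarnessLib

/-!
# No domino cube law with a part of size `4` over any `A ↠ ℤ_19 × ℤ_19`

ω-census `pub-omega`, family (b3), seat pub-omega-group gen 21 (kit of gen 20).  Framing: lottery ticket; floor = certified
bounds/negative ranges.  VALUE: kernel theorems of the `ℤ_p²`-quotient column (`p = 19`, part `4`) of the Dih-side mod-one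
classification — the census cells `(1,4,30)@361` and every larger order, any `c₀` — as instances of the generic
`DominoZpZpCells.lean` (cover hypothesis `exists_table_entry_19_4` assembled here from the kernel cover files, certified line
table `tableZ19d4c`, half `η = 10` from `DominoZ19Z19Cells.lean`); NOT progress on ω.  Companion of `DominoZ19Z19Cells.lean`
(parts landed earlier); new declarations only.

* `no_law_cube_14e_of_onto_z19z19` / `no_law_cube_1d4_of_onto_z19z19`.
-/

namespace Summit.MatrixMultiplication.OmegaCensus

open Finset ZpZpDomino Literature.Combinatorics.Additive

variable {A : Type} [AddCommGroup A] [DecidableEq A] [Fintype A] {G : Type} [Group G] [DecidableEq G]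
  {ρ τ : A → G} {c₀ : A} {S T U : Finset G}

namespace ZpZpDomino

/-- Every entry of the part-`4` table is a valid certificate. [folklore] -/
theorem tableZ19d4c_cert : ∀ e ∈ tableZ19d4c, lineCert 19 (vecFn e.1) e.2 = true := by
  intro e he
  simp only [tableZ19d4c, List.mem_append] at he
  rcases he with (((he | he) | he) | he) | he
  · exact tableZ19d4ca_cert e he
  · exact tableZ19d4cb_cert e he
  · exact tableZ19d4cc_cert e he
  · exact tableZ19d4cd_cert e he
  · exact tableZ19d4ce_cert e he

/-- **Every value function of sum `4` on `ZMod 19 × ZMod 19` (as `361` values) in normal form has a line direction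
whose count vector is, up to a unit scaling of `ZMod 19`, a certified entry of the canonical table.** [folklore] -/
theorem exists_table_entry_19_4 (g : Fin (19 * 19) → ℕ) (hg : ∑ i, g i = 4)
    (hNF : (1 ≤ g ⟨19, by decide⟩ ∧ 1 ≤ g ⟨1, by decide⟩) ∨
      (1 ≤ g ⟨19, by decide⟩ ∧ ∀ i : Fin (19 * 19), i.val % 19 ≠ 0 → g i = 0) ∨ (∀ i : Fin (19 * 19), i.val ≠ 0 → g i = 0)) :
    ∃ j < 19 + 1, ∃ k : ℕ, k % 19 ≠ 0 ∧ ∃ e ∈ tableZ19d4c, ∀ v < 19,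
      e.1.getD (k * v % 19) 0 = ∑ i : Fin (19 * 19), pick v (pv 19 j i.val) (g i) := by
  refine exists_entry_of_cover_scaledH prime19 tableZ19d4c passTreeZ19d4 passTreeZ19d4_sound (K := 3) (m := 5) (by norm_num)
    (fun k hk => ?_) cover_19_4_nf2 cover_19_4_nf3 ⟨19, by decide⟩ ⟨1, by decide⟩ rfl rfl g hg hNF
  interval_cases k
  · exact cover_19_4_nf1_0
  · exact cover_19_4_nf1_1
  · exact cover_19_4_nf1_2
  · exact cover_19_4_nf1_3
  · exact cover_19_4_nf1_4

end ZpZpDomino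

/-- **Cell form `(1, 4, e)` over `A ↠ ℤ_19²**: no TPP triple with coset parts `(1,1 | 4,4 | e,e)` attains the mod-one law
`3|S||T||U| + 8 = 8|A|` in a dihedral-like group over any finite abelian `A ↠ ℤ_19 × ℤ_19` (all orders, any `c₀`). [folklore] -/
theorem no_law_cube_14e_of_onto_z19z19
    (hρρ : ∀ a b, ρ a * ρ b = ρ (a + b)) (hρτ : ∀ a b, ρ a * τ b = τ (b - a))
    (hτρ : ∀ a b, τ a * ρ b = τ (a + b)) (hττ : ∀ a b, τ a * τ b = ρ (c₀ + b - a))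
    (hρ : Function.Injective ρ) (hτ : Function.Injective τ) (hne : ∀ a b, ρ a ≠ τ b)
    (hsurj : ∀ g, (∃ a, ρ a = g) ∨ (∃ a, τ a = g))
    (φ : A →+ ZMod 19 × ZMod 19) (hφ : Function.Surjective φ)
    (h : TripleProductProperty S T U)
    (hS₀ : (univ.filter fun a : A => ρ a ∈ S).card = 1) (hS₁ : (univ.filter fun a : A => τ a ∈ S).card = 1)
    (hT₀ : (univ.filter fun a : A => ρ a ∈ T).card = 4) (hT₁ : (univ.filter fun a : A => τ a ∈ T).card = 4)
    (hU : (univ.filter fun a : A => ρ a ∈ U).card = (univ.filter fun a : A => τ a ∈ U).card)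
    (hV : 3 * (S.card * T.card * U.card) + 8 = 8 * Fintype.card A) : False := by
  haveI : Fact (Nat.Prime 19) := ⟨prime19⟩
  exact no_law_cube_1de_of_onto_zpzp_of_cover (10 : ZMod 19) half_zmod19 tableZ19d4c tableZ19d4c_cert ⟨19, by decide⟩ ⟨1, by decide⟩ rfl rfl
    exists_table_entry_19_4 hρρ hρτ hτρ hττ hρ hτ hne hsurj φ hφ h hS₀ hS₁ hT₀ hT₁ hU hV

/-- **Cell form `(1, d, 4)`** over `A ↠ ℤ_19²` (the parts `4` in `U`). [folklore] -/
theorem no_law_cube_1d4_of_onto_z19z19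
    (hρρ : ∀ a b, ρ a * ρ b = ρ (a + b)) (hρτ : ∀ a b, ρ a * τ b = τ (b - a))
    (hτρ : ∀ a b, τ a * ρ b = τ (a + b)) (hττ : ∀ a b, τ a * τ b = ρ (c₀ + b - a))
    (hρ : Function.Injective ρ) (hτ : Function.Injective τ) (hne : ∀ a b, ρ a ≠ τ b)
    (hsurj : ∀ g, (∃ a, ρ a = g) ∨ (∃ a, τ a = g))
    (φ : A →+ ZMod 19 × ZMod 19) (hφ : Function.Surjective φ)
    (h : TripleProductProperty S T U)
    (hS₀ : (univ.filter fun a : A => ρ a ∈ S).card = 1) (hS₁ : (univ.filter fun a : A => τ a ∈ S).card = 1)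
    (hT : (univ.filter fun a : A => ρ a ∈ T).card = (univ.filter fun a : A => τ a ∈ T).card)
    (hU₀ : (univ.filter fun a : A => ρ a ∈ U).card = 4) (hU₁ : (univ.filter fun a : A => τ a ∈ U).card = 4)
    (hV : 3 * (S.card * T.card * U.card) + 8 = 8 * Fintype.card A) : False := by
  haveI : Fact (Nat.Prime 19) := ⟨prime19⟩
  exact no_law_cube_1d_e_of_onto_zpzp_of_cover (10 : ZMod 19) half_zmod19 tableZ19d4c tableZ19d4c_cert ⟨19, by decide⟩ ⟨1, by decide⟩ rfl rfl
    exists_table_entry_19_4 hρρ hρτ hτρ hττ hρ hτ hne hsurj φ hφ h hS₀ hS₁ hT hU₀ hU₁ hV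

end Summit.MatrixMultiplication.OmegaCensus
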